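import Literature.NumberTheory.EllipticCurves.PastenValuationProductThm115Proofs
import Literature.NumberTheory.EllipticCurves.ModularityVersionApProofs
import Literature.NumberTheory.EllipticCurves.RootNumberProofs
import Literature.NumberTheory.EllipticCurves.LeadingTermTamagawaProofs
import Literature.NumberTheory.EllipticCurves.TamagawaFiniteIndexProofs
import Literature.NumberTheory.EllipticCurves.NeronComponentIndexTypeI0starProofs
import Literature.NumberTheory.EllipticCurves.PAdicHeights
import Summits.BirchSwinnertonDyer.Rank1Residual.Additive.LocalThreeTorsionIffTamagawaThreeOfIVHolds
import Summits.BirchSwinnertonDyer.Rank1Residual.Additive.KodairaDictionaryThree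
import Summits.BirchSwinnertonDyer.Rank1Residual.Additive.DictionaryUniform
import Summits.BirchSwinnertonDyer.Rank1Residual.Additive.GordManinConstantDegree
import Summits.BirchSwinnertonDyer.Rank1Residual.Additive.KatoDescentRankOneCountContraOfFacts
import Summits.BirchSwinnertonDyer.Rank1Residual.Additive.PotSupersingularClasses
import Summits.BirchSwinnertonDyer.Rank1Residual.X11b.BDPRouteTamagawaSupport
import HarnessLib

/-!
# Route `RamifiedHeegnerPair`, crux U₁ `LeafRankOneUpperAtThree` (stmt-BirchSwinnertonDyer-26022), line `offhabitat` —
# (ATLAS): the OFF-HABITAT ATLAS, UNCONDITIONAL (bookkeeping over Tate's table)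

HONEST FRAMING. One unconditional theorem about elliptic curves over `ℚ` (no named-fact hypothesis, no `sorry`); helper file
(`--supports stmt-BirchSwinnertonDyer-26022 --as helper`). It is the registered stub `stub_offHabitatAtlas` of the line of record
`Cruxes/LeafRankOneUpperAtThree/Lines/offhabitat.lean` (v2) with the line's three row predicates `HabSC`, `TwoMultCarriers`,
`WildTwoCarrier` UNFOLDED (they are workfile definitions, not importable); the skeleton discharges its stub by `exact` on this theorem.
Nothing here closes U₁; BSD is proved for no curve. Lead prover bsd-line-rhp-p2 g54, 2026-08-30.

THE ARGUMENT. `W/ℚ` globally minimal, cell `(G) ∧ ss` at `3` (so Kodaira `I₀*` at `3` and `c₃ ∈ {1, 2, 4}`: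
`subGord_three_iff_kodairaSymbolAt_Istar_zero`, `localTamagawaNumber_of_kodairaSymbolAt_eq_Istar_zero_holds`), conductor `N`. Call a prime
`q` a CARRIER when `3 ∣ c_q` (then `q` is bad, `q ∣ N`, `q ≠ 3`). «Not mono» — no single `q ∣ N` with `ord₃ Tam(W) ≤ ord₃ c_q` — gives TWO
distinct carriers, because `Tam(W) = ∏_{v bad} c_v` (`tamagawaProduct_eq_prod`) so `ord₃ Tam = Σ ord₃ c_v`. If two carriers are
multiplicative we are in region R1 (`TwoMultCarriers`). Otherwise some carrier `x` is ADDITIVE, so `ρ̄₃` is onto by the (IMAGE) clause; if `2`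
is a carrier with `8 ∣ N` we are in region R2 (`WildTwoCarrier`). Otherwise every additive carrier `q` has `q ≠ 3`, `q² ∣ N`
(`sq_dvd_conductorNorm_of_addv`) and `q³ ∤ N` (`q ≥ 5`: `f_q = 2`, `condExpTwo_of_addv_of_five_le` + `not_pow_dvd_conductorNorm_of_condExp_lt`;
`q = 2`: not R2), i.e. is a Cartan place; with `S := ∅`, `C := {additive carriers}`, `q₁ :=` the unique multiplicative carrier (or `3` if
none) the row lies on the merged habitat `HabSC` (SHAPE and the très-ramifié clause are vacuous: a split-multiplicative `ℓ` with
`3 ∣ ord_ℓ Δ_min = c_ℓ` (`localTamagawaNumber_eq_padicValInt_of_split`) is a multiplicative carrier, hence `= q₁`; (DEG) by its third disjunct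
at `R = ∅`) — contradicting «off `HabSC`». [cite: SilvermanATAEC1994, IV.9.4, Table 4.1; IV.10.2] [cite: PastenShimura2024, Lemma 6.18]
-/

set_option linter.dupNamespace false
set_option autoImplicit false

noncomputable section

open scoped Classical NumberField

open WeierstrassCurve NumberField IsDedekindDomain IsDedekindDomain.HeightOneSpectrum Rat.HeightOneSpectrum
  Literature.NumberTheory.EllipticCurves
  Literature.NumberTheory.EllipticCurves.Rank1Residual
  Summit.BirchSwinnertonDyer.Rank1Residual Summit.BirchSwinnertonDyer.Rank1Residual.Additive

namespace Summit.BirchSwinnertonDyer.BirchSwinnertonDyer.Theorems.LeafOffHabitatAtlas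

/-- `ord₃` of a finite product of non-zero naturals is the sum of the `ord₃`. [folklore] -/
private theorem padicValNat_finset_prod' {ι : Type*} (s : Finset ι) (f : ι → ℕ)
    (hf : ∀ i ∈ s, f i ≠ 0) : padicValNat 3 (∏ i ∈ s, f i) = ∑ i ∈ s, padicValNat 3 (f i) := by
  induction s using Finset.induction_on with
  | empty => simp
  | insert a s ha ih =>
    rw [Finset.prod_insert ha, Finset.sum_insert ha,
      padicValNat.mul (hf a (Finset.mem_insert_self a s))
        (Finset.prod_ne_zero_iff.mpr fun i hi => hf i (Finset.mem_insert_of_mem hi)),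
      ih fun i hi => hf i (Finset.mem_insert_of_mem hi)]

/-- **(ATLAS) — the off-habitat atlas** (the registered stub `stub_offHabitatAtlas` of `Lines/offhabitat.lean` with `HabSC`,
`TwoMultCarriers`, `WildTwoCarrier` unfolded): on a non-CM Gss2 leaf curve `W` of conductor `N` that is NOT mono-carrier, NOT on the
merged Shimura–Cartan habitat `HabSC`, and whose additive Tamagawa-`3` carriers force `ρ̄₃` onto, EITHER two Tamagawa-`3` carriers are
multiplicative OR `2` is a wild carrier (`8 ∣ N`, `3 ∣ c₂`). Pure bookkeeping over Tate's table (see the module docstring). UNCONDITIONAL.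
[cite: SilvermanATAEC1994, IV.9.4, Table 4.1; IV.10.2] [cite: PastenShimura2024, Lemma 6.18] -/
theorem offHabitatAtlas :
    ∀ (W : WeierstrassCurve ℚ) [W.IsElliptic] [W.IsGloballyMinimal] (N : ℕ) [NeZero N],
      ¬ W.HasCM → Addv W 3 → SubGss W 3 → W.conductorNorm ℤ = N →
      ¬ (∃ (q : ℕ) (_ : Fact q.Prime), q ∣ N ∧
          padicValNat 3 W.tamagawaProduct ≤ padicValNat 3 ((W.baseChange ℚ_[q]).localTamagawaNumber ℤ_[q])) →
      ¬ (∃ (_ : W.IsGloballyMinimal), Surj W 3 ∧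
          ∃ (S C : Finset ℕ) (q₁ : ℕ) (_ : Fact q₁.Prime), Even S.card ∧ ¬ W.HasGoodReductionAtPrime q₁ ∧ q₁ ∉ S ∧ q₁ ∉ C ∧
            (∀ ℓ ∈ S, ∃ _ : Fact ℓ.Prime, W.HasMultiplicativeReductionAtPrime ℓ) ∧
            (∀ q ∈ C, ∃ _ : Fact q.Prime, q ≠ 3 ∧ q ^ 2 ∣ W.conductorNorm ℤ ∧ ¬ q ^ 3 ∣ W.conductorNorm ℤ ∧
              3 ∣ (W.baseChange ℚ_[q]).localTamagawaNumber ℤ_[q]) ∧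
            (∀ (q : ℕ) [Fact q.Prime], q ≠ q₁ → q ∉ C → 3 ∣ (W.baseChange ℚ_[q]).localTamagawaNumber ℤ_[q] →
              W.HasSplitMultiplicativeReductionAtPrime q) ∧
            (∀ (ℓ : ℕ) [Fact ℓ.Prime], ℓ ∉ S → ℓ ≠ q₁ → ℓ ∉ C → W.HasSplitMultiplicativeReductionAtPrime ℓ →
              ¬ 3 ∣ padicValInt ℓ W.minimalDiscriminantInt) ∧
            ((∃ ℓ₀ ∈ S, ¬ 3 ∣ padicValInt ℓ₀ W.minimalDiscriminantInt) ∨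
              (∃ ℓ₀ t : ℕ, ∃ _ : Fact ℓ₀.Prime, ∃ _ : Fact t.Prime,
                W.HasMultiplicativeReductionAtPrime ℓ₀ ∧ W.HasMultiplicativeReductionAtPrime t ∧
                ℓ₀ ∉ S ∧ t ∉ S ∧ t ≠ ℓ₀ ∧ ¬ 3 ∣ padicValInt ℓ₀ W.minimalDiscriminantInt) ∨
              (∃ R : Finset ℕ, R ⊆ S ∧ 2 * R.card = S.card ∧ ∀ q ∈ R, q = 2 ∨ ¬ 3 ∣ q - 1))) →
      (¬ Surj W 3 → ∀ (q : ℕ) [Fact q.Prime], q ≠ 3 → Addv W q → ¬ 3 ∣ (W.baseChange ℚ_[q]).localTamagawaNumber ℤ_[q]) →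
      (∃ (ℓ₁ ℓ₂ : ℕ) (_ : Fact ℓ₁.Prime) (_ : Fact ℓ₂.Prime), ℓ₁ ≠ ℓ₂ ∧
          W.HasMultiplicativeReductionAtPrime ℓ₁ ∧ W.HasMultiplicativeReductionAtPrime ℓ₂ ∧
          3 ∣ (W.baseChange ℚ_[ℓ₁]).localTamagawaNumber ℤ_[ℓ₁] ∧ 3 ∣ (W.baseChange ℚ_[ℓ₂]).localTamagawaNumber ℤ_[ℓ₂]) ∨
        (2 ^ 3 ∣ W.conductorNorm ℤ ∧ 3 ∣ (W.baseChange ℚ_[2]).localTamagawaNumber ℤ_[2]) := by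
  intro W _ instMin N _ _hCM hadd hsub hN hmono hHab himg
  -- the local Tamagawa number as a function of a prime (the currency of `tamagawaProduct_eq_prod`)
  let c : Nat.Primes → ℕ := fun x ↦
    haveI := Fact.mk x.2; (W.baseChange ℚ_[(x : ℕ)]).localTamagawaNumber ℤ_[(x : ℕ)]
  by_contra hcon
  rcases not_or.mp hcon with ⟨hTM, hW2⟩
  -- (0) `c₃ ∈ {1, 2, 4}` on the leaf (Kodaira `I₀*` at `3`)
  have hc3 : ¬ 3 ∣ (W.baseChange ℚ_[3]).localTamagawaNumber ℤ_[3] := by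
    have hI0 : W.kodairaSymbolAt (placeOf 3) = .Istar 0 :=
      (subGord_three_iff_kodairaSymbolAt_Istar_zero W hadd).mp hsub.1
    haveI : PerfectField (IsLocalRing.ResidueField ((placeOf 3).adicCompletionIntegers ℚ)) := PerfectField.ofFinite
    have h124 := localTamagawaNumber_of_kodairaSymbolAt_eq_Istar_zero_holds (placeOf 3) W hI0
    rw [← localTamagawaNumber_padic_eq_placeOf W 3] at h124
    rcases h124 with h | h | h <;> rw [h] <;> decide
  -- (1) carriers are bad; bad primes divide `N`
  have hbad_of_carrier : ∀ (q : ℕ) [Fact q.Prime], 3 ∣ (W.baseChange ℚ_[q]).localTamagawaNumber ℤ_[q] →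
      ¬ W.HasGoodReductionAtPrime q := by
    intro q _ hdvd hgood
    rw [localTamagawaNumber_padic_eq_one_of_good_holds W q hgood] at hdvd
    exact absurd (Nat.le_of_dvd Nat.one_pos hdvd) (by norm_num)
  have hdvdN : ∀ (q : ℕ) [Fact q.Prime], ¬ W.HasGoodReductionAtPrime q → q ∣ N := by
    intro q _ hbad
    rw [← hN]; exact (W.dvd_conductorNorm_iff_not_hasGoodReductionAtPrime q).mpr hbad
  -- (2) at most one multiplicative carrier (else region R1)
  have hmult1 : ∀ (m₁ m₂ : ℕ) [Fact m₁.Prime] [Fact m₂.Prime],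
      W.HasMultiplicativeReductionAtPrime m₁ → W.HasMultiplicativeReductionAtPrime m₂ →
      3 ∣ (W.baseChange ℚ_[m₁]).localTamagawaNumber ℤ_[m₁] → 3 ∣ (W.baseChange ℚ_[m₂]).localTamagawaNumber ℤ_[m₂] →
      m₁ = m₂ := by
    intro m₁ m₂ _ _ h₁ h₂ hc₁ hc₂
    by_contra hne
    exact hTM ⟨m₁, m₂, inferInstance, inferInstance, hne, h₁, h₂, hc₁, hc₂⟩
  -- (3) TWO distinct carriers, from «not mono» and `Tam(W) = ∏_{v bad} c_v`
  have hfin : (W.badPlaces ℤ).Finite := W.finite_badPlaces_holds ℤ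
  set S : Finset (HeightOneSpectrum ℤ) := hfin.toFinset with hSdef
  have hS : ∀ v, ¬ W.HasGoodReductionAt v → v ∈ S := fun v hv ↦ by
    rw [hSdef, Set.Finite.mem_toFinset, mem_badPlaces_iff]; exact hv
  have hSbad : ∀ v ∈ S, ¬ W.HasGoodReductionAt v := fun v hv ↦ by
    rw [hSdef, Set.Finite.mem_toFinset, mem_badPlaces_iff] at hv; exact hv
  have hTam : W.tamagawaProduct = ∏ v ∈ S, c (primesEquiv v) := tamagawaProduct_eq_prod W S hS
  have hcne : ∀ v ∈ S, c (primesEquiv v) ≠ 0 := by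
    have h0 : ∏ v ∈ S, c (primesEquiv v) ≠ 0 := by rw [← hTam]; exact (W.tamagawaProduct_pos_holds).ne'
    exact fun v hv ↦ (Finset.prod_ne_zero_iff.mp h0) v hv
  have hval : padicValNat 3 W.tamagawaProduct = ∑ v ∈ S, padicValNat 3 (c (primesEquiv v)) := by
    rw [hTam]; exact padicValNat_finset_prod' S _ hcne
  -- bad at the place `v` ⟹ bad at the prime `primesEquiv v`
  have hbadPrime : ∀ v ∈ S, ¬ (haveI := Fact.mk (primesEquiv v).2; W.HasGoodReductionAtPrime (primesEquiv v : ℕ)) := by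
    intro v hv hgood
    have h := (W.hasGoodReductionAtPrime_iff_hasGoodReductionAt_holds (primesEquiv v)).mp hgood
    rw [Equiv.symm_apply_apply] at h
    exact hSbad v hv h
  have htwo : ∃ v₁ ∈ S, ∃ v₂ ∈ S, v₁ ≠ v₂ ∧ 3 ∣ c (primesEquiv v₁) ∧ 3 ∣ c (primesEquiv v₂) := by
    by_contra hno
    push Not at hno
    by_cases hex : ∃ v₀ ∈ S, 3 ∣ c (primesEquiv v₀)
    · obtain ⟨v₀, hv₀, hP₀⟩ := hex
      have hsum : ∑ v ∈ S, padicValNat 3 (c (primesEquiv v)) = padicValNat 3 (c (primesEquiv v₀)) := by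
        refine Finset.sum_eq_single_of_mem v₀ hv₀ fun v hv hne ↦ ?_
        exact padicValNat.eq_zero_of_not_dvd fun hP ↦ hno v hv v₀ hv₀ hne hP hP₀
      haveI := Fact.mk (primesEquiv v₀).2
      refine hmono ⟨(primesEquiv v₀ : ℕ), inferInstance, hdvdN _ (hbadPrime v₀ hv₀), ?_⟩
      rw [hval, hsum]
    · push Not at hex
      have hsum : ∑ v ∈ S, padicValNat 3 (c (primesEquiv v)) = 0 :=
        Finset.sum_eq_zero fun v hv ↦ padicValNat.eq_zero_of_not_dvd (hex v hv)
      refine hmono ⟨3, inferInstance, hdvdN 3 hadd.1, ?_⟩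
      rw [hval, hsum]; exact Nat.zero_le _
  obtain ⟨v₁, hv₁, v₂, hv₂, hne12, hP₁, hP₂⟩ := htwo
  haveI i₁ : Fact (Nat.Prime (primesEquiv v₁ : ℕ)) := Fact.mk (primesEquiv v₁).2
  haveI i₂ : Fact (Nat.Prime (primesEquiv v₂ : ℕ)) := Fact.mk (primesEquiv v₂).2
  have hab : (primesEquiv v₁ : ℕ) ≠ (primesEquiv v₂ : ℕ) := fun h ↦
    hne12 ((primesEquiv (R := ℤ)).injective (Subtype.ext h))
  have hca : 3 ∣ (W.baseChange ℚ_[(primesEquiv v₁ : ℕ)]).localTamagawaNumber ℤ_[(primesEquiv v₁ : ℕ)] := hP₁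
  have hcb : 3 ∣ (W.baseChange ℚ_[(primesEquiv v₂ : ℕ)]).localTamagawaNumber ℤ_[(primesEquiv v₂ : ℕ)] := hP₂
  -- (4) an ADDITIVE carrier `x`, hence `ρ̄₃` onto
  have hexadd : ∃ (x : ℕ) (_ : Fact x.Prime), Addv W x ∧ 3 ∣ (W.baseChange ℚ_[x]).localTamagawaNumber ℤ_[x] := by
    by_cases hma : W.HasMultiplicativeReductionAtPrime (primesEquiv v₁ : ℕ)
    · by_cases hmb : W.HasMultiplicativeReductionAtPrime (primesEquiv v₂ : ℕ)
      · exact absurd (hmult1 _ _ hma hmb hca hcb) hab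
      · exact ⟨_, i₂, ⟨hbadPrime v₂ hv₂, hmb⟩, hcb⟩
    · exact ⟨_, i₁, ⟨hbadPrime v₁ hv₁, hma⟩, hca⟩
  obtain ⟨x, ix, haddx, hcx⟩ := hexadd
  have hx3 : x ≠ 3 := by
    rintro rfl
    exact hc3 hcx
  have hsurj : Surj W 3 := by
    by_contra hns
    exact himg hns x hx3 haddx hcx
  -- (5) the exempted place `q₁`: the unique multiplicative carrier, or `3` if there is none
  obtain ⟨q₁, iq₁, hq₁bad, hq₁nadd, hq₁uniq⟩ : ∃ (q₁ : ℕ) (_ : Fact q₁.Prime), ¬ W.HasGoodReductionAtPrime q₁ ∧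
      ¬ (Addv W q₁ ∧ 3 ∣ (W.baseChange ℚ_[q₁]).localTamagawaNumber ℤ_[q₁]) ∧
      (∀ (m : ℕ) [Fact m.Prime], W.HasMultiplicativeReductionAtPrime m →
        3 ∣ (W.baseChange ℚ_[m]).localTamagawaNumber ℤ_[m] → m = q₁) := by
    by_cases hm : ∃ (m : ℕ) (_ : Fact m.Prime), W.HasMultiplicativeReductionAtPrime m ∧
        3 ∣ (W.baseChange ℚ_[m]).localTamagawaNumber ℤ_[m]
    · obtain ⟨m, im, hmm, hcm⟩ := hm
      exact ⟨m, im, hbad_of_carrier m hcm, fun h ↦ h.1.2 hmm, fun m' _ hm' hc' ↦ hmult1 m' m hm' hmm hc' hcm⟩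
    · push Not at hm
      exact ⟨3, inferInstance, hadd.1, fun h ↦ hc3 h.2, fun m' _ hm' hc' ↦ (hm m' inferInstance hm' hc').elim⟩
  -- (6) the Cartan set `C` := the additive carriers
  let P : HeightOneSpectrum ℤ → Prop := fun v ↦
    haveI := Fact.mk (primesEquiv v).2; Addv W (primesEquiv v : ℕ) ∧ 3 ∣ c (primesEquiv v)
  set C : Finset ℕ := (S.filter P).image (fun v ↦ (primesEquiv v : ℕ)) with hCdef
  have hCprime : ∀ q ∈ C, q.Prime := by
    intro q hq
    obtain ⟨v, -, rfl⟩ := Finset.mem_image.mp hq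
    exact (primesEquiv v).2
  have hCmem : ∀ (q : ℕ) [Fact q.Prime], q ∈ C → Addv W q ∧ 3 ∣ (W.baseChange ℚ_[q]).localTamagawaNumber ℤ_[q] := by
    intro q _ hq
    obtain ⟨v, hv, hvq⟩ := Finset.mem_image.mp hq
    subst hvq
    exact (Finset.mem_filter.mp hv).2
  have hCmem' : ∀ (q : ℕ) [hq : Fact q.Prime], Addv W q → 3 ∣ (W.baseChange ℚ_[q]).localTamagawaNumber ℤ_[q] → q ∈ C := by
    intro q hq haddq hcq
    set v : HeightOneSpectrum ℤ := (primesEquiv (R := ℤ)).symm ⟨q, hq.out⟩ with hvdef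
    have hpv : primesEquiv v = ⟨q, hq.out⟩ := Equiv.apply_symm_apply _ _
    have hvS : v ∈ S := hS v fun hgood ↦
      haddq.1 ((W.hasGoodReductionAtPrime_iff_hasGoodReductionAt_holds ⟨q, hq.out⟩).mpr hgood)
    have key : ∀ y : Nat.Primes, y = ⟨q, hq.out⟩ →
        (haveI := Fact.mk y.2; Addv W (y : ℕ) ∧ 3 ∣ c y) := by
      rintro y rfl
      exact ⟨haddq, hcq⟩
    refine Finset.mem_image.mpr ⟨v, Finset.mem_filter.mpr ⟨hvS, key _ hpv⟩, ?_⟩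
    rw [hpv]
  -- (7) every additive carrier is a Cartan place (not region R2 at `q = 2`; `f_q = 2` at `q ≥ 5`)
  have hCclause : ∀ q ∈ C, ∃ _ : Fact q.Prime, q ≠ 3 ∧ q ^ 2 ∣ W.conductorNorm ℤ ∧ ¬ q ^ 3 ∣ W.conductorNorm ℤ ∧
      3 ∣ (W.baseChange ℚ_[q]).localTamagawaNumber ℤ_[q] := by
    intro q hq
    haveI iq : Fact q.Prime := ⟨hCprime q hq⟩
    obtain ⟨haddq, hcq⟩ := hCmem q hq
    have hq3 : q ≠ 3 := by
      rintro rfl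
      exact hc3 hcq
    refine ⟨iq, hq3, ContraCount.sq_dvd_conductorNorm_of_addv W q haddq, ?_, hcq⟩
    by_cases hq2 : q = 2
    · subst hq2
      exact fun h8 ↦ hW2 ⟨h8, hcq⟩
    · have hq5 : 5 ≤ q := iq.out.five_le_of_ne_two_of_ne_three hq2 hq3
      have hfe : condExp W q = 2 := condExpTwo_of_addv_of_five_le W q hq5 haddq
      exact not_pow_dvd_conductorNorm_of_condExp_lt W q (by rw [hfe]; norm_num)
  -- (8) the row lies on the merged habitat `HabSC` with `S := ∅`, `C`, `q₁` — contradiction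
  refine hHab ⟨instMin, hsurj, ∅, C, q₁, iq₁, by simp, hq₁bad, by simp, fun h ↦ hq₁nadd (hCmem q₁ h),
    fun ℓ hℓ ↦ by simp at hℓ, hCclause, ?_, ?_, Or.inr (Or.inr ⟨∅, by simp, by simp, by simp⟩)⟩
  · -- SHAPE: a carrier off `q₁` and `C` cannot exist (multiplicative ⟹ `= q₁`; additive ⟹ `∈ C`)
    intro q _ hne hnotC hcq
    by_cases hmq : W.HasMultiplicativeReductionAtPrime q
    · exact absurd (hq₁uniq q hmq hcq) hne
    · exact absurd (hCmem' q ⟨hbad_of_carrier q hcq, hmq⟩ hcq) hnotC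
  · -- très ramifié: a split-multiplicative `ℓ` with `3 ∣ ord_ℓ Δ_min = c_ℓ` is a multiplicative carrier, hence `= q₁`
    intro ℓ _ _ hne _ hsplit h3
    have hcℓ : 3 ∣ (W.baseChange ℚ_[ℓ]).localTamagawaNumber ℤ_[ℓ] := by
      rw [X11b.localTamagawaNumber_eq_padicValInt_of_split W (placeOf ℓ) (primesEquiv_placeOf_val ℓ) hsplit]
      exact h3
    exact hne (hq₁uniq ℓ hsplit.toHasMultiplicativeReduction hcℓ)

end Summit.BirchSwinnertonDyer.BirchSwinnertonDyer.Theorems.LeafOffHabitatAtlas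

end
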